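import Literature.NumberTheory.Automorphic.MirabolicFourierStage
import Literature.NumberTheory.Automorphic.AutomorphicRepsGL
import HarnessLib

/-!
# The last column group is the unipotent radical of `P_{(n-1,1)}`: the cusp condition kills the
constant term of the top Fourier–Whittaker stage
(Cogdell, *Analytic theory of L-functions for GL_n* (2004), §1.1, proof of Thm. 1.1: "`φ_0 = 0` by
cuspidality"; Borel–Jacquet (1979), §4.4)

Topic `NumberTheory/Automorphic`; namespace `Literature.NumberTheory.Automorphic`. Sequel to
`MirabolicFourierStage`, whose stage identity `hasSum_norm_sq_colCoeff(_mirabolic)` takes the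
vanishing of the `ξ = 0` column coefficient `colCoeff h ν φ 0 x` as a hypothesis. For the **last
column** (`c + 2 = n`: the column group `u : 𝔸_K^{n-1} → GL_n(𝔸_K)` is the unipotent radical
`N_{n-1} = 1 + 𝔫_{n-1}` of the maximal parabolic `P_{(n-1,1)}`) that hypothesis is exactly the
tree's left-convention cusp condition `CuspConditionGL n K φ (n - 1)` of `AutomorphicRepsGL`
(`∫_𝓕 φ((1 + X) x) dν(X) = 0` for every Haar measure `ν` and fundamental domain `𝓕` of `𝔫_{n-1}(K)`
in `𝔫_{n-1}(𝔸_K)`), transported along the additive homeomorphism `v ↦ (0 v; 0 0)`: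

* `colBlockEquiv hn : (Fin (c+1) → 𝔸_K) ≃+ blockNilpotent n (c+1) 𝔸_K` (**definition**, `c + 2 = n`),
  `colBlockHomeomorph` (the same map as a homeomorphism), `colBlockEquiv_mem_rationalBlock_iff`
  (it matches the lattices `K^{c+1}` and `𝔫_{c+1}(K)`), `unipotentOfBlock_colBlockEquiv`
  (`1 + colBlockEquiv v = u(v)`);
* `isAddFundamentalDomain_image_colBlockEquiv` — the image of Tate's box `D^{c+1}` is a fundamental
  domain of `𝔫_{c+1}(K)` for the transported Haar measure (Mathlib
  `IsAddFundamentalDomain.image_of_equiv`);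
* `setIntegral_colUnipotent_eq_zero_of_cuspConditionGL`, **`colCoeff_zero_eq_zero_of_cuspConditionGL`**:
  for `φ` with `CuspConditionGL n K φ (c + 1)` and `c + 2 = n`,
  `∫_{D^{c+1}} φ(u(v) x) dν(v) = 0` and `colCoeff h ν φ 0 x = 0` for every `x` and every Haar `ν`.

With `cuspConditionGL_invQuot_iff_holds` (`AutomorphicRepsGLCuspBridgeProofs`) this applies to
`φ = invQuot f` for every continuous cusp form `f` on `GL_n(𝔸_K) ⧸ A_G GL_n(K)` in the tree's sense
(`IsContinuousCuspForm`), not re-derived here. Lower columns (`c + 2 < n`) are NOT covered: there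
the `ξ = 0` coefficient of the iterated coefficient involves the previous stages (next file).

## References

* J. W. Cogdell, in Bernstein–Gelbart (eds.), *An Introduction to the Langlands Program* (2004),
  §1.1, proof of Thm. 1.1 [CogdellAnalyticTheory2004].
* A. Borel, H. Jacquet, Corvallis (1979), §4.4 [BorelJacquet1979].
-/

noncomputable section

open scoped Matrix ComplexConjugate ENNReal Pointwise
open NumberField IsDedekindDomain MeasureTheory Function
open Literature.LinearAlgebra.Matrix

namespace Literature.NumberTheory.Automorphic

/-! ### The last column as the block `𝔫_{n-1}` -/

section Equiv

variable {R : Type*} [CommRing R] {n c : ℕ}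

/-- In `(c+1, n-(c+1))`-block form with `c + 2 = n`, the right blocks have a single column: every
`j : Fin (n - (c+1))` is `0`. [folklore] -/
theorem fin_sub_eq_zero (hn : c + 2 = n) (j : Fin (n - (c + 1))) : (j : ℕ) = 0 := by
  have := j.isLt
  omega

/-- The index `0 : Fin (n - (c+1))` (non-empty as `c + 2 = n`). [folklore] -/
def finSubZero (hn : c + 2 = n) : Fin (n - (c + 1)) := ⟨0, by omega⟩

/-- **The last column group is the block `𝔫_{c+1}`** (`c + 2 = n`): the additive isomorphism
`v ↦ (0 v; 0 0)` from `R^{c+1}` onto the block-nilpotent matrices `blockNilpotent n (c+1) R`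
(`cornerBlock ∘ colVec` of `MirabolicFourierStage`; inverse: read off the last column). [folklore] -/
def colBlockEquiv (hn : c + 2 = n) : (Fin (c + 1) → R) ≃+ blockNilpotent n (c + 1) R where
  toFun v := cornerBlock (show c + 1 ≤ n by omega) (colVec n v)
  invFun X i := (X : Matrix (Fin n) (Fin n) R) (finBlockEquiv (show c + 1 ≤ n by omega) (Sum.inl i))
    (finBlockEquiv (show c + 1 ≤ n by omega) (Sum.inr (finSubZero hn)))
  left_inv v := by
    funext i
    simp [coe_cornerBlock, Matrix.reindex_apply, finSubZero]
  right_inv X := by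
    refine Subtype.ext (Matrix.ext fun i j => ?_)
    have hX := X.2
    obtain ⟨x, rfl⟩ := (finBlockEquiv (show c + 1 ≤ n by omega)).surjective i
    obtain ⟨y, rfl⟩ := (finBlockEquiv (show c + 1 ≤ n by omega)).surjective j
    simp only [coe_cornerBlock, Matrix.reindex_apply, Matrix.submatrix_apply, Equiv.symm_apply_apply]
    rcases x with a | b <;> rcases y with a' | b'
    · rw [Matrix.fromBlocks_apply₁₁, Matrix.zero_apply]
      symm
      by_contra hne
      have := (hX _ _ hne).2
      rw [coe_finBlockEquiv_inl] at this
      exact absurd a'.isLt (not_lt.2 this)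
    · rw [Matrix.fromBlocks_apply₁₂, colVec_apply, if_pos (fin_sub_eq_zero hn b')]
      have hb' : b' = finSubZero hn := Fin.ext (fin_sub_eq_zero hn b')
      rw [hb']
    · rw [Matrix.fromBlocks_apply₂₁, Matrix.zero_apply]
      symm
      by_contra hne
      have := (hX _ _ hne).1
      rw [coe_finBlockEquiv_inr] at this
      omega
    · rw [Matrix.fromBlocks_apply₂₂, Matrix.zero_apply]
      symm
      by_contra hne
      have := (hX _ _ hne).1
      rw [coe_finBlockEquiv_inr] at this
      omega
  map_add' v w := by
    simp only [map_add]

/-- `colBlockEquiv hn v = cornerBlock _ (colVec n v)` (definitional). [folklore] -/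
theorem colBlockEquiv_apply (hn : c + 2 = n) (v : Fin (c + 1) → R) :
    colBlockEquiv hn v = cornerBlock (show c + 1 ≤ n by omega) (colVec n v) :=
  rfl

/-- The inverse reads off the last column (definitional). [folklore] -/
theorem colBlockEquiv_symm_apply (hn : c + 2 = n) (X : blockNilpotent n (c + 1) R) (i : Fin (c + 1)) :
    (colBlockEquiv hn).symm X i = (X : Matrix (Fin n) (Fin n) R)
      (finBlockEquiv (show c + 1 ≤ n by omega) (Sum.inl i))
      (finBlockEquiv (show c + 1 ≤ n by omega) (Sum.inr (finSubZero hn))) :=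
  rfl

/-- `1 + colBlockEquiv v = u(v)`: the unipotent of the block is the column unipotent
(definitional). [folklore] -/
theorem unipotentOfBlock_colBlockEquiv (hn : c + 2 = n) (v : Fin (c + 1) → R) :
    unipotentOfBlock n (c + 1) R (Multiplicative.ofAdd (colBlockEquiv hn v)) =
      colUnipotent n (show c + 1 ≤ n by omega) (Multiplicative.ofAdd v) :=
  rfl

variable [TopologicalSpace R]

/-- `colBlockEquiv` is continuous. [folklore] -/
theorem continuous_colBlockEquiv (hn : c + 2 = n) :
    Continuous (colBlockEquiv (R := R) hn) := by
  refine Continuous.subtype_mk ?_ _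
  change Continuous fun v : Fin (c + 1) → R =>
    Matrix.reindex (finBlockEquiv (show c + 1 ≤ n by omega)) (finBlockEquiv (show c + 1 ≤ n by omega))
      (Matrix.fromBlocks 0 (colVec n v) 0 0)
  refine Continuous.matrix_reindex ?_ _ _
  refine Continuous.matrix_fromBlocks continuous_const ?_ continuous_const continuous_const
  refine continuous_matrix fun i j => ?_
  simp only [colVec_apply]
  split_ifs
  · exact continuous_apply i
  · exact continuous_const

/-- The inverse of `colBlockEquiv` is continuous (matrix entries). [folklore] -/
theorem continuous_colBlockEquiv_symm (hn : c + 2 = n) :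
    Continuous (colBlockEquiv (R := R) hn).symm := by
  refine continuous_pi fun i => ?_
  change Continuous fun X : blockNilpotent n (c + 1) R => (X : Matrix (Fin n) (Fin n) R)
    (finBlockEquiv (show c + 1 ≤ n by omega) (Sum.inl i))
    (finBlockEquiv (show c + 1 ≤ n by omega) (Sum.inr (finSubZero hn)))
  exact (Continuous.matrix_elem continuous_subtype_val _ _)

/-- `colBlockEquiv` as a homeomorphism `R^{c+1} ≃ₜ 𝔫_{c+1}(R)`. [folklore] -/
def colBlockHomeomorph (hn : c + 2 = n) : (Fin (c + 1) → R) ≃ₜ blockNilpotent n (c + 1) R where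
  toEquiv := (colBlockEquiv hn).toEquiv
  continuous_toFun := continuous_colBlockEquiv hn
  continuous_invFun := continuous_colBlockEquiv_symm hn

/-- The homeomorphism is the additive equivalence as a map (definitional). [folklore] -/
@[simp]
theorem coe_colBlockHomeomorph (hn : c + 2 = n) :
    ⇑(colBlockHomeomorph (R := R) hn) = colBlockEquiv hn :=
  rfl

end Equiv

/-! ### Lattices, Haar measures and fundamental domains along the equivalence -/

section Adelic

variable (K : Type) [Field K] [NumberField K] {n c : ℕ}

variable {K} in
/-- **`colBlockEquiv` matches the lattices**: `(0 v; 0 0) ∈ 𝔫_{c+1}(K)` iff `v ∈ K^{c+1}`.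
[folklore] -/
theorem colBlockEquiv_mem_rationalBlock_iff (hn : c + 2 = n) (v : Fin (c + 1) → AdeleRing (𝓞 K) K) :
    colBlockEquiv hn v ∈ rationalBlock n (c + 1) K ↔ v ∈ piPrincipalSubgroup K (Fin (c + 1)) := by
  rw [mem_rationalBlock_iff, mem_piPrincipalSubgroup_iff]
  constructor
  · intro h i
    have := h (finBlockEquiv (show c + 1 ≤ n by omega) (Sum.inl i))
      (finBlockEquiv (show c + 1 ≤ n by omega) (Sum.inr (finSubZero hn)))
    rwa [← colBlockEquiv_symm_apply hn, AddEquiv.symm_apply_apply] at this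
  · intro h i j
    obtain ⟨x, rfl⟩ := (finBlockEquiv (show c + 1 ≤ n by omega)).surjective i
    obtain ⟨y, rfl⟩ := (finBlockEquiv (show c + 1 ≤ n by omega)).surjective j
    rw [colBlockEquiv_apply, coe_cornerBlock]
    simp only [Matrix.reindex_apply, Matrix.submatrix_apply, Equiv.symm_apply_apply]
    rcases x with a | b <;> rcases y with a' | b'
    · exact ⟨0, by simp⟩
    · rw [Matrix.fromBlocks_apply₁₂, colVec_apply, if_pos (fin_sub_eq_zero hn b')]
      exact h a
    · exact ⟨0, by simp⟩
    · exact ⟨0, by simp⟩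

/-- The induced bijection of lattices `𝔫_{c+1}(K) ≃ K^{c+1}` (as subtypes). [folklore] -/
def rationalBlockEquivPi (hn : c + 2 = n) :
    rationalBlock n (c + 1) K ≃ piPrincipalSubgroup K (Fin (c + 1)) where
  toFun γ := ⟨(colBlockEquiv hn).symm γ, by
    rw [← colBlockEquiv_mem_rationalBlock_iff hn, AddEquiv.apply_symm_apply]; exact γ.2⟩
  invFun ξ := ⟨colBlockEquiv hn ξ, (colBlockEquiv_mem_rationalBlock_iff hn _).2 ξ.2⟩
  left_inv γ := Subtype.ext (by simp)
  right_inv ξ := Subtype.ext (by simp)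

variable [MeasurableSpace (AdeleRing (𝓞 K) K)] [BorelSpace (AdeleRing (𝓞 K) K)]

variable {K} in
/-- **The transported measure is a Haar measure**: the image of an additive Haar measure of
`𝔸_K^{c+1}` under `colBlockEquiv` is an additive Haar measure of `𝔫_{c+1}(𝔸_K)` (Mathlib
`AddEquiv.isAddHaarMeasure_map` for the homeomorphic group isomorphism). [folklore] -/
theorem isAddHaarMeasure_map_colBlockEquiv (hn : c + 2 = n)
    (ν : Measure (Fin (c + 1) → AdeleRing (𝓞 K) K)) [ν.IsAddHaarMeasure] :
    (Measure.map (colBlockEquiv hn) ν :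
      Measure (blockNilpotent n (c + 1) (AdeleRing (𝓞 K) K))).IsAddHaarMeasure := by
  haveI := t2Space_adeleRing K
  haveI := secondCountableTopology_adeleRing K
  haveI : BorelSpace (Fin (c + 1) → AdeleRing (𝓞 K) K) := Pi.borelSpace
  exact AddEquiv.isAddHaarMeasure_map ν (colBlockEquiv hn) (continuous_colBlockEquiv hn)
    (continuous_colBlockEquiv_symm hn)

variable {K} in
/-- `colBlockEquiv` is measure preserving onto the transported measure (by definition) and a
measurable embedding (a homeomorphism). [folklore] -/
theorem measurePreserving_colBlockEquiv (hn : c + 2 = n)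
    (ν : Measure (Fin (c + 1) → AdeleRing (𝓞 K) K)) :
    MeasurePreserving (colBlockEquiv hn) ν
      (Measure.map (colBlockEquiv hn) ν : Measure (blockNilpotent n (c + 1) (AdeleRing (𝓞 K) K))) := by
  haveI := t2Space_adeleRing K
  haveI := secondCountableTopology_adeleRing K
  haveI : BorelSpace (Fin (c + 1) → AdeleRing (𝓞 K) K) := Pi.borelSpace
  exact ⟨(continuous_colBlockEquiv hn).measurable, rfl⟩

variable {K} in
/-- **The image of Tate's box is a fundamental domain of `𝔫_{c+1}(K)`** for the transported
measure: `colBlockEquiv '' D^{c+1}` is an `IsAddFundamentalDomain` for the translation action of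
`rationalBlock n (c+1) K` on `𝔫_{c+1}(𝔸_K)` (Mathlib `IsAddFundamentalDomain.image_of_equiv`
applied to `isAddFundamentalDomain_op_piFundamentalDomain`, the lattices corresponding under
`rationalBlockEquivPi`). [folklore] -/
theorem isAddFundamentalDomain_image_colBlockEquiv (hn : c + 2 = n)
    (ν : Measure (Fin (c + 1) → AdeleRing (𝓞 K) K)) :
    IsAddFundamentalDomain (rationalBlock n (c + 1) K)
      (colBlockEquiv hn '' piFundamentalDomain K (Fin (c + 1)))
      (Measure.map (colBlockEquiv hn) ν : Measure (blockNilpotent n (c + 1) (AdeleRing (𝓞 K) K))) := by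
  haveI := t2Space_adeleRing K
  haveI := secondCountableTopology_adeleRing K
  haveI : BorelSpace (Fin (c + 1) → AdeleRing (𝓞 K) K) := Pi.borelSpace
  have hD := isAddFundamentalDomain_op_piFundamentalDomain K (Fin (c + 1)) ν
  set e : rationalBlock n (c + 1) K ≃ (piPrincipalSubgroup K (Fin (c + 1))).op :=
    (rationalBlockEquivPi K hn).trans (AddSubgroup.equivOp _) with he
  have hme : MeasurableEmbedding (colBlockEquiv (R := AdeleRing (𝓞 K) K) hn) :=
    (colBlockHomeomorph (R := AdeleRing (𝓞 K) K) hn).measurableEmbedding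
  have hmp := measurePreserving_colBlockEquiv hn ν
  refine hD.image_of_equiv (colBlockEquiv hn).toEquiv ?_ e fun γ v => ?_
  · -- `colBlockEquiv.symm` is measure preserving back
    have hsymm : MeasurePreserving (colBlockEquiv (R := AdeleRing (𝓞 K) K) hn).symm
        (Measure.map (colBlockEquiv hn) ν) ν := by
      have := hmp.symm (colBlockHomeomorph (R := AdeleRing (𝓞 K) K) hn).toMeasurableEquiv
      exact this
    exact hsymm.quasiMeasurePreserving
  · -- equivariance: `Ψ (v + γ') = γ + Ψ v` with `γ' = Ψ⁻¹ γ`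
    change colBlockEquiv hn (v + ((colBlockEquiv hn).symm γ : Fin (c + 1) → AdeleRing (𝓞 K) K)) =
      (γ : blockNilpotent n (c + 1) (AdeleRing (𝓞 K) K)) + colBlockEquiv hn v
    rw [map_add, AddEquiv.apply_symm_apply]
    exact add_comm _ _

/-! ### The cusp condition kills the constant term of the last column -/

variable {K} in
/-- **Cuspidality along `P_{(n-1,1)}` in column coordinates**: if `φ : GL_n(𝔸_K) → ℂ` satisfies the
left cusp condition `CuspConditionGL n K φ (c + 1)` and `c + 2 = n`, then
`∫_{D^{c+1}} φ(u(v) x) dν(v) = 0` for every `x` and every additive Haar measure `ν` on `𝔸_K^{c+1}`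
(apply the condition to the transported pair `(map Ψ ν, Ψ '' D^{c+1})` and change variables back
along the measurable embedding `Ψ = colBlockEquiv`). [cite: CogdellAnalyticTheory2004, §1.1] -/
theorem setIntegral_colUnipotent_eq_zero_of_cuspConditionGL (h : c + 1 ≤ n) (hn : c + 2 = n)
    (ν : Measure (Fin (c + 1) → AdeleRing (𝓞 K) K)) [ν.IsAddHaarMeasure]
    {φ : GL (Fin n) (AdeleRing (𝓞 K) K) → ℂ} (hφ : CuspConditionGL n K φ (c + 1))
    (x : GL (Fin n) (AdeleRing (𝓞 K) K)) :
    ∫ v in piFundamentalDomain K (Fin (c + 1)), φ (colUnipotent n h (Multiplicative.ofAdd v) * x) ∂ν = 0 := by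
  haveI := t2Space_adeleRing K
  haveI := secondCountableTopology_adeleRing K
  haveI : BorelSpace (Fin (c + 1) → AdeleRing (𝓞 K) K) := Pi.borelSpace
  haveI := isAddHaarMeasure_map_colBlockEquiv hn ν
  have h0 := (hφ (Measure.map (colBlockEquiv hn) ν) (colBlockEquiv hn '' piFundamentalDomain K (Fin (c + 1)))
    (isAddFundamentalDomain_image_colBlockEquiv hn ν) x).2
  have hme : MeasurableEmbedding (colBlockEquiv (R := AdeleRing (𝓞 K) K) hn) :=
    (colBlockHomeomorph (R := AdeleRing (𝓞 K) K) hn).measurableEmbedding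
  rw [(measurePreserving_colBlockEquiv hn ν).setIntegral_image_emb hme] at h0
  exact h0

variable {K} in
/-- **The `ξ = 0` column coefficient of the last column vanishes for `φ` cuspidal along
`P_{(n-1,1)}`**: `colCoeff h ν φ 0 x = 0` for every `x` — the hypothesis `hcusp` of
`hasSum_norm_sq_colCoeff` / `hasSum_norm_sq_colCoeff_mirabolic` of `MirabolicFourierStage` at the
top stage (Cogdell (2004), proof of Thm. 1.1: "`φ_0 = 0` since `φ` is cuspidal").
[cite: CogdellAnalyticTheory2004, §1.1] -/
theorem colCoeff_zero_eq_zero_of_cuspConditionGL (h : c + 1 ≤ n) (hn : c + 2 = n)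
    (ν : Measure (Fin (c + 1) → AdeleRing (𝓞 K) K)) [ν.IsAddHaarMeasure]
    {φ : GL (Fin n) (AdeleRing (𝓞 K) K) → ℂ} (hφ : CuspConditionGL n K φ (c + 1))
    (x : GL (Fin n) (AdeleRing (𝓞 K) K)) :
    colCoeff h ν φ 0 x = 0 := by
  rw [colCoeff_zero, setIntegral_colUnipotent_eq_zero_of_cuspConditionGL h hn ν hφ x, smul_zero]

end Adelic

end Literature.NumberTheory.Automorphic
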